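import Summits.Ventures.PercRepro.Night2LocalDGenCell

/-!
# PercRepro — THE `(7, 5)` CELLS `(3, 0)` AND `(3, 1)` FOR LARGE FLATS (night-2, gen 19)

At `q = 5`, `d = 3` (`t = q − d + 1 = 3` top levels) the bases-only regime holds at `(3, 0)` (`ρ = 6`, `k = 0`:
`λ = c′ = 1/15`) and at `(3, 1)` (`ρ = 5`, `k = 1`: `λ = 11/120`, `c′ = 1/120`).  The target sums read
`dgenSum n 5 3 6 0 = (A/15 + T) / ((2/5) C(n, 6))` and `dgenSum n 5 3 5 1 = (A/120 + T) / ((11/24) C(n, 5))` with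
`A = Aρt n ρ 3 = Σ_{i=ρ+1}^{n−3} C(n, i)` and `T = Ttop n 3 = C(n, 2) + n + 1`, so the cells need

  `(3, 0)`: `6 C(n, 6) ≤ A + 15 T` — true for every `n ≥ 16` (`three_zero_ineq`; it FAILS at `n ∈ {8, 10, …, 15}`),
  `(3, 1)`: `55 C(n, 5) ≤ A + 120 T` — true for every `n ≥ 20` (`three_one_ineq`; it fails at `n ≤ 19`),

proved for the bounded range through the identity `Σ_{i≤ρ} C(n, i) + A + T = 2^n` (`sum_range_add_Aρt_add_Ttop`) and
kernel evaluation, and for large `n` from the growth of the first two (resp. four) middle binomials.  Hence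
**`localShadowHall_three_zero_five_of_card`** (`|G| ≥ 16`) and **`localShadowHall_three_one_five_of_card`**
(`|G| ≥ 21`): with `Night2LocalSpread` the cells `(3, 0)` and `(3, 1)` are open only for BOUNDED flats carrying a fat
hyperplane (`proofs/NIGHT-2-g19.md` §6).
-/

namespace PercRepro.Shadow

open Finset PerFlat ThmH

namespace DGen

/-- `Σ_{i ≤ ρ} C(n, i) + Aρt n ρ t + Ttop n t = 2^n` for `ρ + t ≤ n`. -/
theorem sum_range_add_Aρt_add_Ttop {n ρ t : ℕ} (hn : ρ + t ≤ n) :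
    (∑ i ∈ Finset.range (ρ + 1), n.choose i) + Aρt n ρ t + Ttop n t = 2 ^ n := by
  unfold Aρt Ttop
  rw [← Nat.sum_range_choose n, Finset.range_eq_Ico, Finset.range_eq_Ico,
    Finset.sum_Ico_consecutive _ (by omega : 0 ≤ ρ + 1) (by omega : ρ + 1 ≤ n + 1 - t),
    Finset.sum_Ico_consecutive _ (by omega : 0 ≤ n + 1 - t) (by omega : n + 1 - t ≤ n + 1)]

/-- `Aρt n ρ t ≥ C(n, ρ+1) + C(n, ρ+2)` for `ρ + t + 2 ≤ n`. -/
theorem Aρt_ge_two {n ρ t : ℕ} (hn : ρ + t + 2 ≤ n) : n.choose (ρ + 1) + n.choose (ρ + 2) ≤ Aρt n ρ t := by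
  unfold Aρt
  have hsub : Finset.Ico (ρ + 1) (ρ + 3) ⊆ Finset.Ico (ρ + 1) (n + 1 - t) := by
    intro i hi; rw [Finset.mem_Ico] at hi ⊢; omega
  have h := Finset.sum_le_sum_of_subset (f := fun i => n.choose i) hsub
  rw [Finset.sum_Ico_succ_top (by omega), Finset.sum_Ico_succ_top (by omega), Finset.Ico_self,
    Finset.sum_empty, zero_add] at h
  exact h

/-- `Aρt n ρ t ≥ C(n, ρ+1) + C(n, ρ+2) + C(n, ρ+3) + C(n, ρ+4)` for `ρ + t + 4 ≤ n`. -/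
theorem Aρt_ge_four {n ρ t : ℕ} (hn : ρ + t + 4 ≤ n) :
    n.choose (ρ + 1) + n.choose (ρ + 2) + n.choose (ρ + 3) + n.choose (ρ + 4) ≤ Aρt n ρ t := by
  unfold Aρt
  have hsub : Finset.Ico (ρ + 1) (ρ + 5) ⊆ Finset.Ico (ρ + 1) (n + 1 - t) := by
    intro i hi; rw [Finset.mem_Ico] at hi ⊢; omega
  have h := Finset.sum_le_sum_of_subset (f := fun i => n.choose i) hsub
  rw [Finset.sum_Ico_succ_top (by omega), Finset.sum_Ico_succ_top (by omega),
    Finset.sum_Ico_succ_top (by omega), Finset.sum_Ico_succ_top (by omega), Finset.Ico_self,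
    Finset.sum_empty, zero_add] at h
  exact h

/-! ## The cell `(3, 0)` -/

/-- `λ = 1/15` at `(q, d, ρ, k) = (5, 3, 6, 0)`. -/
theorem lambdaDG_five_three_six_zero : lambdaDG 5 3 6 0 = 1 / 15 := by
  unfold lambdaDG capDG reqDG phiQ; norm_num

/-- `c′ = 1/15` at `(q, d, ρ, k) = (5, 3, 6, 0)`. -/
theorem cPrimeDG_five_three_six_zero : cPrimeDG 5 3 6 0 = 1 / 15 := by
  unfold cPrimeDG capDG reqDG phiQ; norm_num

/-- `C(n, 7) + C(n, 8) ≥ 6 C(n, 6)` for `n ≥ 22`. -/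
theorem six_choose_six_le {n : ℕ} (hn : 22 ≤ n) : 6 * n.choose 6 ≤ n.choose 7 + n.choose 8 := by
  obtain ⟨m, rfl⟩ : ∃ m, n = m + 22 := ⟨n - 22, by omega⟩
  have h7 := Nat.choose_succ_right_eq (m + 22) 6
  have h8 := Nat.choose_succ_right_eq (m + 22) 7
  rw [show m + 22 - 6 = m + 16 by omega] at h7
  rw [show m + 22 - 7 = m + 15 by omega] at h8
  nlinarith [h7, h8, Nat.zero_le ((m + 22).choose 6), Nat.zero_le ((m + 22).choose 7)]

/-- The bounded range `16 ≤ n ≤ 21` of the `(3, 0)` inequality. -/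
theorem three_zero_ineq_small {n : ℕ} (hn : 16 ≤ n) (hn' : n ≤ 21) :
    6 * n.choose 6 ≤ Aρt n 6 3 + 15 * Ttop n 3 := by
  have hid : (∑ i ∈ Finset.range 7, n.choose i) + Aρt n 6 3 + Ttop n 3 = 2 ^ n :=
    sum_range_add_Aρt_add_Ttop (by omega)
  have key : 6 * n.choose 6 + (∑ i ∈ Finset.range 7, n.choose i) ≤ 2 ^ n + 14 * Ttop n 3 := by
    unfold Ttop
    interval_cases n <;> decide
  omega

/-- **The `(3, 0)` inequality** `6 C(n, 6) ≤ A₆(n) + 15 T(n)` for every `n ≥ 16`. -/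
theorem three_zero_ineq {n : ℕ} (hn : 16 ≤ n) : 6 * n.choose 6 ≤ Aρt n 6 3 + 15 * Ttop n 3 := by
  by_cases h : n ≤ 21
  · exact three_zero_ineq_small hn h
  · push Not at h
    have hA : n.choose 7 + n.choose 8 ≤ Aρt n 6 3 := Aρt_ge_two (by omega)
    have h2 := six_choose_six_le (by omega : 22 ≤ n)
    omega

/-- **The target sum of the cell `(3, 0)` is at least `1`** for every `n ≥ 16`. -/
theorem one_le_dgenSum_three_zero {n : ℕ} (hn : 16 ≤ n) : 1 ≤ dgenSum n 5 3 6 0 := by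
  have hlam : 0 < lambdaDG 5 3 6 0 := by rw [lambdaDG_five_three_six_zero]; norm_num
  rw [dgenSum_eq (by norm_num; omega) (by norm_num) hlam, lambdaDG_five_three_six_zero,
    cPrimeDG_five_three_six_zero]
  have hC : (0 : ℚ) < (n.choose 6 : ℚ) := by exact_mod_cast Nat.choose_pos (by omega)
  rw [le_div_iff₀ (by positivity)]
  have key := three_zero_ineq hn
  have key' : (6 : ℚ) * (n.choose 6 : ℚ) ≤ (Aρt n 6 3 : ℚ) + 15 * (Ttop n 3 : ℚ) := by exact_mod_cast key
  norm_num
  linarith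

/-! ## The cell `(3, 1)` -/

/-- `λ = 11/120` at `(q, d, ρ, k) = (5, 3, 5, 1)`. -/
theorem lambdaDG_five_three_five_one : lambdaDG 5 3 5 1 = 11 / 120 := by
  unfold lambdaDG capDG reqDG phiQ; norm_num

/-- `c′ = 1/120` at `(q, d, ρ, k) = (5, 3, 5, 1)`. -/
theorem cPrimeDG_five_three_five_one : cPrimeDG 5 3 5 1 = 1 / 120 := by
  unfold cPrimeDG capDG reqDG phiQ; norm_num

/-- `C(n, 6) + C(n, 7) + C(n, 8) + C(n, 9) ≥ 55 C(n, 5)` for `n ≥ 24`. -/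
theorem fiftyfive_choose_five_le {n : ℕ} (hn : 24 ≤ n) :
    55 * n.choose 5 ≤ n.choose 6 + n.choose 7 + n.choose 8 + n.choose 9 := by
  obtain ⟨m, rfl⟩ : ∃ m, n = m + 24 := ⟨n - 24, by omega⟩
  have h6 := Nat.choose_succ_right_eq (m + 24) 5
  have h7 := Nat.choose_succ_right_eq (m + 24) 6
  have h8 := Nat.choose_succ_right_eq (m + 24) 7
  have h9 := Nat.choose_succ_right_eq (m + 24) 8
  rw [show m + 24 - 5 = m + 19 by omega] at h6
  rw [show m + 24 - 6 = m + 18 by omega] at h7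
  rw [show m + 24 - 7 = m + 17 by omega] at h8
  rw [show m + 24 - 8 = m + 16 by omega] at h9
  have l6 : 19 * (m + 24).choose 5 ≤ 6 * (m + 24).choose 6 := by
    nlinarith [h6, Nat.zero_le ((m + 24).choose 5 * m)]
  have l7 : 18 * (m + 24).choose 6 ≤ 7 * (m + 24).choose 7 := by
    nlinarith [h7, Nat.zero_le ((m + 24).choose 6 * m)]
  have l8 : 17 * (m + 24).choose 7 ≤ 8 * (m + 24).choose 8 := by
    nlinarith [h8, Nat.zero_le ((m + 24).choose 7 * m)]
  have l9 : 16 * (m + 24).choose 8 ≤ 9 * (m + 24).choose 9 := by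
    nlinarith [h9, Nat.zero_le ((m + 24).choose 8 * m)]
  omega

/-- The bounded range `20 ≤ n ≤ 23` of the `(3, 1)` inequality. -/
theorem three_one_ineq_small {n : ℕ} (hn : 20 ≤ n) (hn' : n ≤ 23) :
    55 * n.choose 5 ≤ Aρt n 5 3 + 120 * Ttop n 3 := by
  have hid : (∑ i ∈ Finset.range 6, n.choose i) + Aρt n 5 3 + Ttop n 3 = 2 ^ n :=
    sum_range_add_Aρt_add_Ttop (by omega)
  have key : 55 * n.choose 5 + (∑ i ∈ Finset.range 6, n.choose i) ≤ 2 ^ n + 119 * Ttop n 3 := by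
    unfold Ttop
    interval_cases n <;> decide
  omega

/-- **The `(3, 1)` inequality** `55 C(n, 5) ≤ A₅(n) + 120 T(n)` for every `n ≥ 20`. -/
theorem three_one_ineq {n : ℕ} (hn : 20 ≤ n) : 55 * n.choose 5 ≤ Aρt n 5 3 + 120 * Ttop n 3 := by
  by_cases h : n ≤ 23
  · exact three_one_ineq_small hn h
  · push Not at h
    have hA : n.choose 6 + n.choose 7 + n.choose 8 + n.choose 9 ≤ Aρt n 5 3 := Aρt_ge_four (by omega)
    have h2 := fiftyfive_choose_five_le (by omega : 24 ≤ n)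
    omega

/-- **The target sum of the cell `(3, 1)` is at least `1`** for every `n ≥ 20`. -/
theorem one_le_dgenSum_three_one {n : ℕ} (hn : 20 ≤ n) : 1 ≤ dgenSum n 5 3 5 1 := by
  have hlam : 0 < lambdaDG 5 3 5 1 := by rw [lambdaDG_five_three_five_one]; norm_num
  rw [dgenSum_eq (by norm_num; omega) (by norm_num) hlam, lambdaDG_five_three_five_one,
    cPrimeDG_five_three_five_one]
  have hC : (0 : ℚ) < (n.choose 5 : ℚ) := by exact_mod_cast Nat.choose_pos (by omega)
  rw [le_div_iff₀ (by positivity)]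
  have key := three_one_ineq hn
  have key' : (55 : ℚ) * (n.choose 5 : ℚ) ≤ (Aρt n 5 3 : ℚ) + 120 * (Ttop n 3 : ℚ) := by exact_mod_cast key
  norm_num
  linarith

end DGen

variable {α : Type*} [DecidableEq α] {M : Matroid α} [M.Finite]

open scoped Classical in
/-- **THE `(7, 5)` CELL `(3, 0)` FOR `|G| ≥ 16`**: a simple loopless matroid, a rank-`6` flat `G` with `|E ∖ G| = 3`,
`kColoops (M|G) = 0` and at least `16` points satisfies the local form at `q = 5`. -/
theorem localShadowHall_three_zero_five_of_card {G : Finset α} (hG : G ∈ flatsQ M (5 + 1))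
    (hd : (gr M \ G).card = 3) (hk : kColoops M G = 0)
    (hs : ∀ e ∈ gr M, ∀ f ∈ gr M, e ≠ f → rkN M {e, f} = 2) (hl : ∀ e ∈ gr M, M.Indep {e})
    (h16 : 16 ≤ G.card) : LocalShadowHall M 5 G :=
  localShadowHall_dgen_of_sum (d := 3) (ρ := 6) hG hd (by norm_num) (by rw [hk]) (by norm_num) (by rw [hk]; norm_num)
    hs hl (by rw [hk, DGen.cPrimeDG_five_three_six_zero]; norm_num)
    (by rw [hk, DGen.lambdaDG_five_three_six_zero]; norm_num)
    (by rw [hk]; exact DGen.one_le_dgenSum_three_zero (by omega))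

open scoped Classical in
/-- **THE `(7, 5)` CELL `(3, 1)` FOR `|G| ≥ 21`**: a simple loopless matroid, a rank-`6` flat `G` with `|E ∖ G| = 3`,
`kColoops (M|G) = 1` and at least `21` points satisfies the local form at `q = 5`. -/
theorem localShadowHall_three_one_five_of_card {G : Finset α} (hG : G ∈ flatsQ M (5 + 1))
    (hd : (gr M \ G).card = 3) (hk : kColoops M G = 1)
    (hs : ∀ e ∈ gr M, ∀ f ∈ gr M, e ≠ f → rkN M {e, f} = 2) (hl : ∀ e ∈ gr M, M.Indep {e})
    (h21 : 21 ≤ G.card) : LocalShadowHall M 5 G :=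
  localShadowHall_dgen_of_sum (d := 3) (ρ := 5) hG hd (by norm_num) (by rw [hk]) (by norm_num) (by rw [hk]; norm_num)
    hs hl (by rw [hk, DGen.cPrimeDG_five_three_five_one]; norm_num)
    (by rw [hk, DGen.lambdaDG_five_three_five_one]; norm_num)
    (by rw [hk]; exact DGen.one_le_dgenSum_three_one (by omega))

end PercRepro.Shadow
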